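import Summits.ResolutionOfSingularities.ResolutionOfSingularities.Theorems.FrobeniusClosingNoPeriodicIsolatedAtomConeAlgebraRoom

/-!
# Cone algebra for `NoPeriodicIsolatedAtom` / line `ridge_rank` — near direction, rank drop, and the
# registered stub `stub_coneAlgebra` (crux stmt-ResolutionOfSingularities-16344)

Given the CONE SHAPE `a_p(X_i, X' + τ X_i) = e·X_i^p + G̃(X')` of `F = cone p c` (`G̃ = F|_{X_i = 0}`,
`e = F(e_i + τ)`; a hypothesis, produced by the step dictionary) and a second coefficient function `c'`
with the same `u_i`-free degree-`p` cleaned coefficients: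
* `(X_i + S)^p = X_i^p + S^p` gives the NEAR DIRECTION `v = e_i + τ ∈ L(F) = Linv p c` (`nearDirection`);
* `L(cone p c') ∩ {w_i = 0} ⊆ L(G̃) ∩ {w_i = 0} ⊆ L(F)` (`linv_kill`, `kill_cone_congr`, `linv_subst`), all of
  these are subspaces (`coe_span_Linv`), `v ∈ L(F)` has `v_i = 1`, and a hyperplane section costs at
  most one dimension: `dL p c' ≤ dL p c` (`nearDirection_and_rankDrop`).
All identities are `κ`-algebra-hom manipulations (no evaluation at points: `κ` may be finite).
Together with ROOM (`room`, file `…ConeAlgebraRoom.lean`) this is `stub_coneAlgebra`, stated over the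
exact mirror `Theorems/ConeExit/Negative/Mirror.lean` of the crux calculus with the predicates inlined.
-/

noncomputable section

-- single-problem summit: the doubled namespace component is forced by the tree layout
set_option linter.dupNamespace false

namespace Summit.ResolutionOfSingularities.ResolutionOfSingularities.Theorems.NoPeriodicIsolatedAtom.RidgeRank

open scoped BigOperators Classical
open MvPolynomial
open Summit.ResolutionOfSingularities.ResolutionOfSingularities.Theorems.ConeExit.Negative


variable {n : ℕ} {κ : Type} [Field κ]

/-- Un-shearing after the shear `X_j ↦ X_j + τ_j X_i` is the renaming `X_j ↦ X_{some j}`. [folklore] -/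
theorem unshear_shear (i : Fin n) (τ : Fin n → κ) (P : MvPolynomial (Fin n) κ) :
    aeval (fun j : Fin n => if j = i then (X (some i) : MvPolynomial (Option (Fin n)) κ)
        else X (some j) - C (τ j) * X (some i))
      (aeval (fun j : Fin n => if j = i then X i else X j + C (τ j) * X i) P) = rename some P := by
  rw [← AlgHom.comp_apply]
  congr 1
  refine algHom_ext fun j => ?_
  by_cases hj : j = i
  · subst hj
    simp only [AlgHom.comp_apply, aeval_X, ite_true, rename_X]
  · simp only [AlgHom.comp_apply, aeval_X, if_neg hj, ite_true, map_add, map_mul, algHom_C,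
      algebraMap_eq, rename_X, sub_add_cancel]

/-- The near translate `X ↦ X + (e_i + τ) S` factors through the shear. [folklore] -/
theorem near_shear (i : Fin n) (τ : Fin n → κ) (P : MvPolynomial (Fin n) κ) :
    aeval (fun j : Fin n => if j = i then (X (some i) : MvPolynomial (Option (Fin n)) κ) + X none
        else X (some j) - C (τ j) * X (some i))
      (aeval (fun j : Fin n => if j = i then X i else X j + C (τ j) * X i) P) =
      aeval (fun j : Fin n => (X (some j) : MvPolynomial (Option (Fin n)) κ) +
        C (Function.update τ i 1 j) * X none) P := by
  rw [← AlgHom.comp_apply]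
  congr 1
  refine algHom_ext fun j => ?_
  by_cases hj : j = i
  · subst hj
    simp only [AlgHom.comp_apply, aeval_X, ite_true, Function.update_self, C_1, one_mul]
  · simp only [AlgHom.comp_apply, aeval_X, if_neg hj, ite_true, map_add, map_mul, algHom_C,
      algebraMap_eq, Function.update_of_ne hj]
    ring

/-- A translate `X ↦ X + w S` with `w i = 0` factors through the shear. [folklore] -/
theorem translate_shear (i : Fin n) (τ : Fin n → κ) (w : Fin n → κ) (hwi : w i = 0)
    (P : MvPolynomial (Fin n) κ) :
    aeval (fun j : Fin n => (if j = i then (X (some i) : MvPolynomial (Option (Fin n)) κ)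
        else X (some j) - C (τ j) * X (some i)) + C (w j) * X none)
      (aeval (fun j : Fin n => if j = i then X i else X j + C (τ j) * X i) P) =
      aeval (fun j : Fin n => (X (some j) : MvPolynomial (Option (Fin n)) κ) + C (w j) * X none) P := by
  rw [← AlgHom.comp_apply]
  congr 1
  refine algHom_ext fun j => ?_
  by_cases hj : j = i
  · subst hj
    simp only [AlgHom.comp_apply, aeval_X, ite_true]
  · simp only [AlgHom.comp_apply, aeval_X, if_neg hj, ite_true, map_add, map_mul, algHom_C,
      algebraMap_eq, hwi, C_0, zero_mul, add_zero]
    ring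

/-- Composition with the killing `X_i ↦ 0`. [folklore] -/
theorem aeval_aeval_kill (i : Fin n) {σ : Type} (φ : Fin n → MvPolynomial σ κ) (P : MvPolynomial (Fin n) κ) :
    aeval φ (aeval (fun j : Fin n => if j = i then (0 : MvPolynomial (Fin n) κ) else X j) P) =
      aeval (fun j => if j = i then 0 else φ j) P := by
  rw [← AlgHom.comp_apply]
  congr 1
  refine algHom_ext fun j => ?_
  by_cases hj : j = i
  · subst hj
    simp only [AlgHom.comp_apply, aeval_X, ite_true, map_zero]
  · simp only [AlgHom.comp_apply, aeval_X, if_neg hj]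

/-- Killing `X_i` only depends on the substitution off `i`. [folklore] -/
theorem aeval_kill_congr (i : Fin n) {σ : Type} (φ φ' : Fin n → MvPolynomial σ κ)
    (h : ∀ j, j ≠ i → φ j = φ' j) (P : MvPolynomial (Fin n) κ) :
    aeval (fun j => if j = i then 0 else φ j) P = aeval (fun j => if j = i then 0 else φ' j) P := by
  have : (fun j => if j = i then (0 : MvPolynomial σ κ) else φ j) = fun j => if j = i then 0 else φ' j := by
    funext j
    by_cases hj : j = i
    · rw [if_pos hj, if_pos hj]
    · rw [if_neg hj, if_neg hj, h j hj]
  rw [this]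

/-- Substituting into the cone shape `e X_i^p + G̃`. [folklore] -/
theorem aeval_shape {p : ℕ} (i : Fin n) (e : κ) {σ : Type} (φ : Fin n → MvPolynomial σ κ)
    (G : MvPolynomial (Fin n) κ) :
    aeval φ (C e * X i ^ p + G) = C e * φ i ^ p + aeval φ G := by
  simp only [map_add, map_mul, map_pow, algHom_C, algebraMap_eq, aeval_X]

section Shape

variable {p : ℕ} (c : (Fin n → ℕ) → κ) (i : Fin n) (τ : Fin n → κ) (e : κ)
  (H1 : aeval (fun j : Fin n => if j = i then X i else X j + C (τ j) * X i) (cone p c) =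
    C e * X i ^ p + aeval (fun j : Fin n => if j = i then (0 : MvPolynomial (Fin n) κ) else X j) (cone p c))
include H1

/-- Under the cone shape, `F(X) = e X_i^p + G̃(X' - τ X_i)` read in `κ[Option (Fin n)]`:
`rename some F = e X_{some i}^p + G̃(X_{some j} - τ_j X_{some i})`. [folklore] -/
theorem rename_of_shape :
    rename some (cone p c) = C e * (X (some i) : MvPolynomial (Option (Fin n)) κ) ^ p +
      aeval (fun j : Fin n => if j = i then (0 : MvPolynomial (Option (Fin n)) κ)
        else X (some j) - C (τ j) * X (some i)) (cone p c) := by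
  rw [← unshear_shear i τ (cone p c), H1, aeval_shape, if_pos rfl, aeval_aeval_kill]
  congr 1
  exact aeval_kill_congr i _ _ (fun j hj => by rw [if_neg hj]) (cone p c)

/-- **Translates along `{w_i = 0} ∩ L(G̃)` are in `L(F)`** (Claim A): if `w i = 0` and `w` satisfies the
invariance identity for `G̃ = F|_{X_i=0}`, then it satisfies it for `F`, with constant `G̃(w)`.
[folklore] -/
theorem linv_of_linv_kill (w : Fin n → κ) (hwi : w i = 0)
    (hw : aeval (fun j : Fin n => (X (some j) : MvPolynomial (Option (Fin n)) κ) + C (w j) * X none)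
        (aeval (fun j : Fin n => if j = i then (0 : MvPolynomial (Fin n) κ) else X j) (cone p c)) =
      rename some (aeval (fun j : Fin n => if j = i then (0 : MvPolynomial (Fin n) κ) else X j) (cone p c)) +
        C (eval w (aeval (fun j : Fin n => if j = i then (0 : MvPolynomial (Fin n) κ) else X j) (cone p c))) *
          (X none) ^ p) :
    aeval (fun j : Fin n => (X (some j) : MvPolynomial (Option (Fin n)) κ) + C (w j) * X none) (cone p c) =
      rename some (cone p c) +
        C (eval w (aeval (fun j : Fin n => if j = i then (0 : MvPolynomial (Fin n) κ) else X j) (cone p c))) *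
          (X none) ^ p := by
  have hsub := linv_subst _ w hw (fun j : Fin n => if j = i then (X (some i) : MvPolynomial (Option (Fin n)) κ)
    else X (some j) - C (τ j) * X (some i)) (X none)
  rw [aeval_aeval_kill, aeval_aeval_kill] at hsub
  rw [← translate_shear i τ w hwi (cone p c), H1, aeval_shape, if_pos rfl, hwi, C_0, zero_mul, add_zero,
    aeval_aeval_kill, rename_of_shape c i τ e H1, add_assoc]
  congr 1
  rw [hsub]
  congr 1
  exact aeval_kill_congr i _ _ (fun j hj => by rw [if_neg hj]) (cone p c)

/-- **Near direction under the shape**: `F(X + (e_i + τ) S) = F(X) + e S^p` (characteristic `p`).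
[folklore] -/
theorem near_of_shape [CharP κ p] (hp : p.Prime) :
    aeval (fun j : Fin n => (X (some j) : MvPolynomial (Option (Fin n)) κ) +
        C (Function.update τ i 1 j) * X none) (cone p c) =
      rename some (cone p c) + C e * (X none) ^ p := by
  haveI : Fact p.Prime := ⟨hp⟩
  rw [← near_shear i τ (cone p c), H1, aeval_shape, if_pos rfl, add_pow_char, mul_add, aeval_aeval_kill,
    rename_of_shape c i τ e H1,
    aeval_kill_congr i _ (fun j : Fin n => (X (some j) : MvPolynomial (Option (Fin n)) κ) - C (τ j) * X (some i))
      (fun j hj => by rw [if_neg hj]) (cone p c)]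
  ring

end Shape

/-- **NEAR DIRECTION.** Under the cone shape with `e = F(e_i + τ)`, the vector `v = e_i + τ`
(`Function.update τ i 1`) lies in `Linv p c`. [cite: Hironaka1970AdditiveGroups, Thm 2] -/
theorem nearDirection (p : ℕ) (hp : p.Prime) [CharP κ p] (c : (Fin n → ℕ) → κ) (i : Fin n) (τ : Fin n → κ)
    (H1 : MvPolynomial.aeval (fun j : Fin n => if j = i then MvPolynomial.X i
        else MvPolynomial.X j + MvPolynomial.C (τ j) * MvPolynomial.X i) (cone p c) =
      MvPolynomial.C (MvPolynomial.eval (Function.update τ i 1) (cone p c)) * MvPolynomial.X i ^ p +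
        MvPolynomial.aeval (fun j : Fin n => if j = i then 0 else MvPolynomial.X j) (cone p c)) :
    Function.update τ i 1 ∈ Linv p c := by
  rw [mem_Linv_iff]
  exact near_of_shape c i τ _ H1 hp

/-- **NEAR DIRECTION AND RANK DROP** (conjunct (2) of `stub_coneAlgebra`).
[cite: Hironaka1970AdditiveGroups, Thm 2] -/
theorem nearDirection_and_rankDrop : ∀ p : ℕ, p.Prime → ∀ (n : ℕ) (κ : Type) [Field κ] [CharP κ p]
    (c c' : (Fin n → ℕ) → κ) (i : Fin n) (τ : Fin n → κ),
      MvPolynomial.aeval (fun j : Fin n => if j = i then MvPolynomial.X i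
          else MvPolynomial.X j + MvPolynomial.C (τ j) * MvPolynomial.X i) (cone p c) =
        MvPolynomial.C (MvPolynomial.eval (Function.update τ i 1) (cone p c)) * MvPolynomial.X i ^ p +
          MvPolynomial.aeval (fun j : Fin n => if j = i then 0 else MvPolynomial.X j) (cone p c) →
      (∀ A : Fin n → ℕ, A i = 0 → Finset.sum Finset.univ (fun j => A j) = p → clean p c' A = clean p c A) →
      Function.update τ i 1 ∈ Linv p c ∧ dL p c' ≤ dL p c := by
  intro p hp n κ _ _ c c' i τ H1 H2
  have hv : Function.update τ i 1 ∈ Linv p c := nearDirection p hp c i τ H1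
  refine ⟨hv, ?_⟩
  -- Claims B + A: `L(F') ∩ {w_i = 0} ⊆ L(F)`
  have hAB : ∀ w : Fin n → κ, w i = 0 → w ∈ Linv p c' → w ∈ Linv p c := by
    intro w hwi hw'
    rw [mem_Linv_iff] at hw' ⊢
    have hB := linv_kill (cone p c') i w hwi hw'
    rw [kill_cone_congr p c c' i H2] at hB
    exact linv_of_const (cone p c) (constantCoeff_cone p hp.ne_zero c) w _
      (linv_of_linv_kill c i τ _ H1 w hwi hB)
  -- dimension count
  unfold dL
  have hWmem := mem_span_Linv_iff p hp.ne_zero c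
  have hW'mem := mem_span_Linv_iff p hp.ne_zero c'
  set W := Submodule.span κ (Linv p c) with hW
  set W' := Submodule.span κ (Linv p c') with hW'
  let f : W' →ₗ[κ] κ := (LinearMap.proj i).comp W'.subtype
  have h1 := LinearMap.finrank_range_add_finrank_ker f
  have h2 : Module.finrank κ (LinearMap.range f) ≤ 1 := by
    have := Submodule.finrank_le (LinearMap.range f)
    rwa [Module.finrank_self] at this
  have h3 : Module.finrank κ (LinearMap.ker f) = Module.finrank κ ((LinearMap.ker f).map W'.subtype) :=
    (Submodule.finrank_map_subtype_eq W' (LinearMap.ker f)).symm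
  have h4 : (LinearMap.ker f).map W'.subtype ≤ W ⊓ LinearMap.ker (LinearMap.proj i : (Fin n → κ) →ₗ[κ] κ) := by
    rintro w ⟨x, hx, rfl⟩
    have hxi : (x : Fin n → κ) i = 0 := by
      have := LinearMap.mem_ker.mp hx
      simpa [f] using this
    refine Submodule.mem_inf.mpr ⟨?_, ?_⟩
    · exact (hWmem _).mpr ((mem_Linv_iff p c _).mp
        (hAB _ hxi ((mem_Linv_iff p c' _).mpr ((hW'mem _).mp x.property))))
    · rw [LinearMap.mem_ker, LinearMap.proj_apply]
      exact hxi
  have h5 : W ⊓ LinearMap.ker (LinearMap.proj i : (Fin n → κ) →ₗ[κ] κ) < W := by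
    refine lt_of_le_of_ne inf_le_left fun heq => ?_
    have hvW : Function.update τ i 1 ∈ W := (hWmem _).mpr ((mem_Linv_iff p c _).mp hv)
    rw [← heq] at hvW
    have h0 := (Submodule.mem_inf.mp hvW).2
    rw [LinearMap.mem_ker, LinearMap.proj_apply, Function.update_self] at h0
    exact one_ne_zero h0
  have h6 := Submodule.finrank_lt_finrank_of_lt h5
  have h7 := Submodule.finrank_mono h4
  omega

/-- **CONE ALGEBRA** — the registered stub `stub_coneAlgebra` of line `ridge_rank`: (1) ROOM
`OrdP c → dL c + 2 ≤ n`; (2) cone shape + equal `u_i`-free parts ⇒ near direction `e_i + τ ∈ Linv p c`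
and rank drop `dL c' ≤ dL c`. Stated over the mirror calculus (token-identical to the skeleton's
`let`-block), so it closes the skeleton's stub by definitional unfolding.
[cite: Hironaka1970AdditiveGroups, Thm 2] -/
theorem stub_coneAlgebra :
    (∀ p : ℕ, p.Prime → ∀ (n : ℕ) (κ : Type) [Field κ] [CharP κ p] (c : (Fin n → ℕ) → κ), (∃ A,
      clean p c A ≠ 0 ∧ Finset.sum Finset.univ (fun j => A j) = p) → dL p c + 2 ≤ n) ∧ (∀ p : ℕ,
      p.Prime → ∀ (n : ℕ) (κ : Type) [Field κ] [CharP κ p] (c c' : (Fin n → ℕ) → κ) (i : Fin n) (τ :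
      Fin n → κ), MvPolynomial.aeval (fun j : Fin n => if j = i then MvPolynomial.X i else
      MvPolynomial.X j + MvPolynomial.C (τ j) * MvPolynomial.X i) (cone p c) = MvPolynomial.C
      (MvPolynomial.eval (Function.update τ i 1) (cone p c)) * MvPolynomial.X i ^ p +
      MvPolynomial.aeval (fun j : Fin n => if j = i then 0 else MvPolynomial.X j) (cone p c) → (∀ A
      : Fin n → ℕ, A i = 0 → Finset.sum Finset.univ (fun j => A j) = p → clean p c' A = clean p c A)
      → Function.update τ i 1 ∈ Linv p c ∧ dL p c' ≤ dL p c) :=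
  ⟨room, nearDirection_and_rankDrop⟩

end Summit.ResolutionOfSingularities.ResolutionOfSingularities.Theorems.NoPeriodicIsolatedAtom.RidgeRank

end
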